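import Summits.AnomalousDissipation.AnomalousDissipation.Theorems.GalerkinInvariantLoud.Negative.Atoms

/-!
# Negative knowledge for the crux `MomentParity.GalerkinInvariantLoud` (stmt-AnomalousDissipation-14283), IV:
# the mean-flow row — an energy floor independent of `ε`

Certified copy of §5 of the cdisprove work file `Cruxes/GalerkinInvariantLoud/Disproof.lean`
(refuter-cdisprove-stmt-AnomalousDissipation-14283-0, cycle 1). Supports stmt-AnomalousDissipation-14283; no
conclusion asserts a Theses decl positively.

* `nsGeneratorPairing_polyGrad_X` — the row of the linear observable `(u, g₀)` is `⟨F(u), g₀⟩`.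
* `exists_energyFloor` — for a smooth force `f` there is `C = C(f) ≥ 0` with `∫‖f‖² ≤ |ν|‖Δf‖₂√E + C E` for every
  witness at a level carrying `f` (only the linear row, the support bound and `ensembleEnergy ≤ E` are used).
-/

namespace Summit.AnomalousDissipation.AnomalousDissipation.Theorems.GalerkinInvariantLoud.Negative

open MeasureTheory Filter Topology
open scoped ENNReal InnerProductSpace RealInnerProductSpace
open Literature.Analysis.FunctionSpaces Literature.Analysis.FluidPDE
open Summit.AnomalousDissipation.AnomalousDissipation.Theses.MomentParity
open Summit.AnomalousDissipation.AnomalousDissipation.Theorems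
open Summit.AnomalousDissipation.AnomalousDissipation.Theorems.QuarticGate.Negative

noncomputable section

open Summit.AnomalousDissipation.AnomalousDissipation.Theorems.CubicParityLoud.Negative
  (T3 R3 H3 L2T3 integrable_pairing)

/-! ## §5 NEW — the mean-flow (linear) row: an ENERGY FLOOR independent of `ε`

The linear rows say `P_N f = νAū + P_N⟨B(u,u)⟩` (mean momentum balance). Tested against `f` itself (when `f`
is carried by level `N`, e.g. any trigonometric-polynomial force at `N ≥ deg f`):
`‖f‖₂² = −ν⟨(u, Δf)⟩ − ⟨∫(u⊗u):∇f⟩ ≤ |ν| ‖Δf‖₂ √E + C_f E`, `C_f = sup Σᵢ‖∂ᵢf‖`. So the energy budget of a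
witness is bounded BELOW by a constant of the force alone, `E ≥ min(1, ‖f‖₂⁴/(4ν²‖Δf‖₂²), ‖f‖₂²/(2C_f))`,
whatever `ε` (the force floor `E ≥ (ε/‖f‖₂)²` degenerates as `ε → 0`; this one does not). Holds verbatim for
the lower rungs (degree-1 tests). -/

section EnergyFloor

/-- The row of the linear observable `(u, f)` is the generator tested against `f`. -/
theorem nsGeneratorPairing_polyGrad_X {ν : ℝ} {f : T3 → R3} (hfs : Torus.IsSmooth f) (g₀ : T3 → R3)
    (hg₀ : Torus.IsSmooth g₀) (u : H3) :
    Torus.nsGeneratorPairing ν f u (polyGrad (fun _ : Fin 1 => g₀) (MvPolynomial.X 0) u) =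
      Torus.nsGeneratorPairing ν f u g₀ := by
  rw [nsGeneratorPairing_polyGrad (hfs.continuous.integrable_unitAddTorus) (fun _ => hg₀)]
  simp

/-- **ENERGY FLOOR (mean-flow row).** For a smooth force `f` there is `C = C(f) ≥ 0` such that every witness at a
level carrying `f` obeys `∫‖f‖² ≤ |ν| ‖Δf‖₂ √E + C E`. Only the linear row of `(u,f)`, the support bound and
`ensembleEnergy ≤ E` are used. -/
theorem exists_energyFloor {f : T3 → R3} (hfs : Torus.IsSmooth f) :
    ∃ C : ℝ, 0 ≤ C ∧ ∀ {ν : ℝ} {N : ℕ} {R E ε : ℝ} {μ : Measure H3}, IsBandTest N f →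
      IsGILWitness f ν N R E ε μ →
        ∫ x, ‖f x‖ ^ 2 ≤ |ν| * Real.sqrt (∫ x, ‖Torus.laplacian f x‖ ^ 2) * Real.sqrt E + C * E := by
  obtain ⟨C, hC0, hC⟩ := Torus.exists_sum_norm_partialDeriv_le hfs
  refine ⟨C, hC0, fun {ν N R E ε μ} hfB hW => ?_⟩
  obtain ⟨hp, hl, hR, hinv, hE, -⟩ := hW
  have hΔ : MemLp (Torus.laplacian f) 2 volume := hfs.laplacian.memLp 2
  -- the linear row of `(u, f)`
  obtain ⟨hGi, hG0⟩ := hinv 1 (fun _ => f) (MvPolynomial.X 0) (fun _ => hfB)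
  simp_rw [nsGeneratorPairing_polyGrad_X hfs f hfs] at hGi hG0
  -- the three summands
  set P : H3 → ℝ := fun u => Torus.pairing u.1 (Torus.laplacian f) with hPdef
  set Q : H3 → ℝ := fun u => Torus.inertialPairing (u : L2T3) f with hQdef
  have hff : ∫ x, ⟪f x, f x⟫_ℝ = ∫ x, ‖f x‖ ^ 2 :=
    integral_congr_ae (ae_of_all _ fun x => real_inner_self_eq_norm_sq (f x))
  have hexp : ∀ u : H3, Torus.nsGeneratorPairing ν f u f = (∫ x, ‖f x‖ ^ 2) + ν * P u + Q u := by
    intro u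
    unfold Torus.nsGeneratorPairing
    rw [hff]
    rfl
  have h1 : Integrable (fun u : H3 => ‖u‖) μ := by simpa using integrable_norm_pow_of_ae_le hR 1
  have h2 : Integrable (fun u : H3 => ‖u‖ ^ 2) μ := integrable_norm_pow_of_ae_le hR 2
  have hPint : Integrable P μ := integrable_pairing hΔ h1
  have hQbd : ∀ u : H3, |Q u| ≤ C * ‖u‖ ^ 2 := fun u => by
    have h := (Torus.integrable_inner_fderiv_apply_coe hfs hC (u : L2T3) (u : L2T3)).2
    rw [hQdef]
    dsimp only
    rw [Torus.inertialPairing, sq]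
    exact h
  have hQint : Integrable Q μ :=
    Integrable.mono' (h2.const_mul C) (Torus.continuous_inertialPairing_coe hfs).aestronglyMeasurable
      (ae_of_all _ fun u => by rw [Real.norm_eq_abs]; exact hQbd u)
  -- integrate the row
  have h12' : Integrable (fun u : H3 => ν * P u) μ := hPint.const_mul ν
  have h12 : Integrable (fun u : H3 => (∫ x, ‖f x‖ ^ 2) + ν * P u) μ := (integrable_const _).add h12'
  have hsum : (∫ x, ‖f x‖ ^ 2) + ν * (∫ u, P u ∂μ) + ∫ u, Q u ∂μ = 0 := by
    have h := hG0
    simp_rw [hexp] at h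
    rw [integral_add h12 hQint, integral_add (integrable_const _) h12', integral_const_mul, integral_const,
      smul_eq_mul, probReal_univ, one_mul] at h
    exact h
  -- bounds
  have hE0 : 0 ≤ Torus.ensembleEnergy μ := integral_nonneg fun u => by positivity
  have hEE : Torus.ensembleEnergy μ ≤ E := hE
  have hPb : |∫ u, P u ∂μ| ≤ ‖hΔ.toLp (Torus.laplacian f)‖ * Real.sqrt E := by
    calc |∫ u, P u ∂μ| ≤ ∫ u, |P u| ∂μ := abs_integral_le_integral_abs
      _ ≤ ∫ u, ‖u‖ * ‖hΔ.toLp (Torus.laplacian f)‖ ∂μ :=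
          integral_mono hPint.abs (h1.mul_const _) fun u => Torus.abs_pairing_coe_le hΔ u
      _ = (∫ u, ‖u‖ ∂μ) * ‖hΔ.toLp (Torus.laplacian f)‖ := integral_mul_const _ _
      _ ≤ Real.sqrt (Torus.ensembleEnergy μ) * ‖hΔ.toLp (Torus.laplacian f)‖ := by
          refine mul_le_mul_of_nonneg_right ?_ (norm_nonneg _)
          exact (le_abs_self _).trans (Real.abs_le_sqrt (CubicParityLoud.Negative.sq_integral_norm_le h2))
      _ ≤ Real.sqrt E * ‖hΔ.toLp (Torus.laplacian f)‖ :=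
          mul_le_mul_of_nonneg_right (Real.sqrt_le_sqrt hEE) (norm_nonneg _)
      _ = ‖hΔ.toLp (Torus.laplacian f)‖ * Real.sqrt E := mul_comm _ _
  have hQb : |∫ u, Q u ∂μ| ≤ C * E := by
    calc |∫ u, Q u ∂μ| ≤ ∫ u, |Q u| ∂μ := abs_integral_le_integral_abs
      _ ≤ ∫ u, C * ‖u‖ ^ 2 ∂μ := integral_mono hQint.abs (h2.const_mul C) hQbd
      _ = C * Torus.ensembleEnergy μ := by rw [integral_const_mul]; rfl
      _ ≤ C * E := mul_le_mul_of_nonneg_left hEE hC0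
  rw [CubicParityLoud.Negative.norm_toLp_eq_sqrt] at hPb
  have hνP : |ν * ∫ u, P u ∂μ| ≤ |ν| * (Real.sqrt (∫ x, ‖Torus.laplacian f x‖ ^ 2) * Real.sqrt E) := by
    rw [abs_mul]
    exact mul_le_mul_of_nonneg_left hPb (abs_nonneg ν)
  have key : ∫ x, ‖f x‖ ^ 2 = -(ν * ∫ u, P u ∂μ) - ∫ u, Q u ∂μ := by linarith
  rw [key]
  nlinarith [neg_abs_le (ν * ∫ u, P u ∂μ), le_abs_self (ν * ∫ u, P u ∂μ), neg_abs_le (∫ u, Q u ∂μ),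
    le_abs_self (∫ u, Q u ∂μ)]

end EnergyFloor

end

end Summit.AnomalousDissipation.AnomalousDissipation.Theorems.GalerkinInvariantLoud.Negative
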